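import Summits.BirchSwinnertonDyer.BirchSwinnertonDyer.Theorems.ThetaPartnerAtTwoSignedTransportAtTwoResidualRigidityTools
import HarnessLib

/-!
# Residual rigidity at `2`: `Gal(ℚ̄₂/ℚ₂)`-equivariant automorphisms of `E(ℚ̄₂)[2]` are trivial at a good supersingular `2`
# — for the crux `SignedTransportAtTwo` (stmt-BirchSwinnertonDyer-20333, route `ThetaPartnerAtTwo`, line `bridge` v16,
# stub `stub_sel2Tb` step T5) (lead prover bsd-wall-tp2-p1 g5; `--supports stmt-BirchSwinnertonDyer-20333`;
# route-independent, closes nothing)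

HONEST FRAMING. THEOREMS ONLY (no definition); nothing about any Selmer group is asserted; BSD is not proved by any of this.
No import of any route file.

WHY. The local transport stub `stub_sel2Tb` asks for a `Gal(ℚ̄₂/ℚ₂)`-equivariant homomorphism `Ψ : W(ℚ̄₂) → A(ℚ̄₂)`
RESTRICTING TO A GIVEN equivariant `ẽ : W[2] ≃ A[2]`. The Honda construction produces some equivariant `Ψ`; that its
restriction to `W[2]` is `ẽ` is the statement that equivariant isomorphisms `W[2] ≃ A[2]` are UNIQUE, i.e. that the only
`Gal(ℚ̄₂/ℚ₂)`-equivariant automorphism of `E(ℚ̄₂)[2]` is the identity. This file proves it: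

* §1 (group theory) `apply_eq_self_of_commute`: on an abelian group `V` of order `4` acted on by a group `G` with (i) no
  non-zero `G`-fixed vector and (ii) SOME `g ∈ G` fixing a non-zero vector without acting trivially, every injective
  additive `β : V → V` commuting with `G` is the identity (Lagrange in a group of order `4`: the fixed group of `β`,
  resp. of `g`, has order `2` and is `G`-, resp. `β`-stable).
* §2 (ii) for `V = E(ℚ̄₂)[2]` (`exists_smul_eq_and_smul_ne`): otherwise every `σ` permutes the three points of order `2`
  by an EVEN permutation, so `d = (x₁−x₂)(x₁−x₃)(x₂−x₃) ∈ ℚ₂` and `Δ_min = 16d²`, contradicting `Δ_min ≡ 5 (mod 8)`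
  (tools file); (i) is `eq_zero_of_forall_smul_eq_of_two_nsmul_padic` of the tools file.
* §3 `residualRigidity_two`: the assembled statement, and the two-maps form used by the transport stub
  (`eq_of_injective_of_equivariant`): two injective "equivariant" additive maps `X → A(ℚ̄₂)` from a group of order `4`
  killed by `2` (e.g. `W[2](ℚ̄)` along `ι : ℚ̄ → ℚ̄₂`) coincide.

References: [Serre1972] §5.3 (image of inertia at a supersingular prime); [SilvermanAEC2009] III.2.3, VIII.§1;
[BDKim2009] Prop. 2.11–2.12 (p. 186); [Kobayashi2003] §8.
-/

set_option autoImplicit false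
-- D-0017: single-problem summit, so `Summit.BirchSwinnertonDyer.BirchSwinnertonDyer.…` repeats a namespace BY DESIGN.
set_option linter.dupNamespace false

noncomputable section

open scoped Classical AddSubgroup

open WeierstrassCurve Literature.NumberTheory.EllipticCurves Literature.NumberTheory.GaloisRepresentations
  Literature.NumberTheory.EllipticCurves.Rank1Residual Field

namespace Summit.BirchSwinnertonDyer.BirchSwinnertonDyer.Theorems.SignedTransportAtTwo

universe u

/-! ## §1 Group theory: rigidity of a `G`-module of order `4` -/

section GroupTheory

variable {V : Type*} [AddCommGroup V] {G : Type*} [Group G] [DistribMulAction G V]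

/-- In a group of order `4`, a subgroup containing a non-zero element and missing some element has exactly the two
elements `0, v`. [folklore] -/
private theorem eq_zero_or_eq_of_card_four (hV : Nat.card V = 4) (S : AddSubgroup V) {v w : V} (hv : v ∈ S)
    (hv0 : v ≠ 0) (hw : w ∉ S) {u : V} (hu : u ∈ S) : u = 0 ∨ u = v := by
  haveI : Finite V := Nat.finite_of_card_ne_zero (by rw [hV]; norm_num)
  have hdvd : Nat.card S ∣ 4 := hV ▸ S.card_addSubgroup_dvd_card
  have hle : Nat.card S ≤ 4 := Nat.le_of_dvd (by norm_num) hdvd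
  have hne4 : Nat.card S ≠ 4 := by
    intro h4
    have : S = ⊤ := S.eq_top_of_card_eq (by rw [h4, hV])
    exact hw (this ▸ AddSubgroup.mem_top w)
  have hne1 : Nat.card S ≠ 1 := by
    intro h1
    have : S = ⊥ := S.eq_bot_of_card_eq h1
    rw [this, AddSubgroup.mem_bot] at hv
    exact hv0 hv
  have h2 : Nat.card S = 2 := by
    interval_cases (Nat.card S) <;> simp_all
  -- `S = {0, v}`
  by_contra hnot
  push Not at hnot
  haveI : Fintype S := Fintype.ofFinite _
  have hlt : 2 < Nat.card S := by
    rw [Nat.card_eq_fintype_card, Fintype.two_lt_card_iff]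
    exact ⟨⟨0, S.zero_mem⟩, ⟨v, hv⟩, ⟨u, hu⟩, by simp [Ne, Subtype.ext_iff, hv0.symm],
      by simp [Ne, Subtype.ext_iff, Ne.symm hnot.1], by simp [Ne, Subtype.ext_iff, Ne.symm hnot.2]⟩
  omega

/-- **Rigidity of a `G`-module of order `4`.** Let `G` act on an abelian group `V` of order `4` so that (i) `V^G = 0`
and (ii) some `g ∈ G` fixes a non-zero vector but does not act trivially. Then every injective additive `β : V → V`
commuting with `G` is the identity. (Applied to `V = E[2] ≅ 𝔽₂²`, `Aut V ≅ S₃`: (i)+(ii) say the image of `G` is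
`S₃`, whose centraliser is trivial.) [folklore] -/
theorem apply_eq_self_of_commute (hV : Nat.card V = 4) (hfix : ∀ v : V, (∀ g : G, g • v = v) → v = 0)
    (hmix : ∃ (g : G) (v w : V), v ≠ 0 ∧ g • v = v ∧ g • w ≠ w) (β : V →+ V)
    (hβinj : Function.Injective β) (hβ : ∀ (g : G) (v : V), β (g • v) = g • β v) (v : V) : β v = v := by
  haveI : Finite V := Nat.finite_of_card_ne_zero (by rw [hV]; norm_num)
  by_contra hv
  -- the fixed group `F` of `β` is `G`-stable and proper
  set F : AddSubgroup V :=
    { carrier := {v | β v = v}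
      zero_mem' := by simp
      add_mem' := by
        intro a b ha hb
        simp only [Set.mem_setOf_eq] at ha hb ⊢
        rw [map_add, ha, hb]
      neg_mem' := by
        intro a ha
        simp only [Set.mem_setOf_eq] at ha ⊢
        rw [map_neg, ha] } with hF
  have hmemF : ∀ {u : V}, u ∈ F ↔ β u = u := fun {u} ↦ Iff.rfl
  have hFstab : ∀ (g : G) {u : V}, u ∈ F → g • u ∈ F := fun g u hu ↦ by
    rw [hmemF] at hu ⊢
    rw [hβ, hu]
  -- Case analysis on whether `F` has a non-zero element.
  by_cases hF0 : ∃ u ∈ F, u ≠ 0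
  · obtain ⟨u, huF, hu0⟩ := hF0
    -- `F = {0, u}` is `G`-stable, so `u` is `G`-fixed: contradiction with (i)
    have hu_fixed : ∀ g : G, g • u = u := fun g ↦ by
      rcases eq_zero_or_eq_of_card_four hV F huF hu0 (w := v) hv (hFstab g huF) with h | h
      · exact absurd (smul_eq_zero_iff_eq g |>.mp h) hu0
      · exact h
    exact hu0 (hfix u hu_fixed)
  · push Not at hF0
    obtain ⟨g, a, w, ha0, hga, hgw⟩ := hmix
    -- the fixed group `S` of `g` is `β`-stable and equals `{0, a}`
    set S : AddSubgroup V :=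
      { carrier := {u | g • u = u}
        zero_mem' := smul_zero g
        add_mem' := by
          intro x y hx hy
          simp only [Set.mem_setOf_eq] at hx hy ⊢
          rw [smul_add, hx, hy]
        neg_mem' := by
          intro x hx
          simp only [Set.mem_setOf_eq] at hx ⊢
          rw [smul_neg, hx] } with hS
    have haS : a ∈ S := hga
    have hwS : w ∉ S := hgw
    have hβa : β a ∈ S := by
      change g • β a = β a
      rw [← hβ, hga]
    rcases eq_zero_or_eq_of_card_four hV S haS ha0 hwS hβa with h | h
    · exact ha0 (hβinj (by rw [h, map_zero]))
    · exact ha0 (hF0 a (hmemF.mpr h))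

end GroupTheory

/-! ## §2 (ii): some `σ ∈ Gal(ℚ̄₂/ℚ₂)` fixes a point of order `2` without fixing `E[2]` -/

section Mixed

open Summit.BirchSwinnertonDyer.Rank1Residual

variable (W : WeierstrassCurve ℚ) [W.IsElliptic] [W.IsGloballyMinimal]

/-- **(ii) Some `σ ∈ Gal(ℚ̄₂/ℚ₂)` fixes a point of order `2` but moves another**, at a good supersingular `2`. Otherwise
every `σ` fixing one point of order `2` fixes all of `E[2]`, so every `σ` permutes the three points of order `2` either
trivially or without fixed point — an EVEN permutation — and fixes `d = (x₁−x₂)(x₁−x₃)(x₂−x₃)`; then `d ∈ ℚ₂` and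
`Δ_min = 16d²`, contradicting `Δ_min ≡ 5 (mod 8)`. (Equivalently: the image of `Gal(ℚ̄₂/ℚ₂)` in `Aut E[2] ≅ S₃` is not
inside `A₃`; it is all of `S₃`.) [cite: Serre1972, §5.3] [cite: SilvermanAEC2009, III.2.3] -/
theorem exists_smul_eq_and_smul_ne (hss : GoodSS W 2) :
    ∃ (σ : absoluteGaloisGroup ℚ_[2]) (P Q : localPoints W ℚ_[2]),
      (2 : ℕ) • P = 0 ∧ P ≠ 0 ∧ σ • P = P ∧ (2 : ℕ) • Q = 0 ∧ σ • Q ≠ Q := by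
  by_contra H
  push Not at H
  -- H : every σ fixing a point of order 2 fixes every 2-torsion point
  obtain ⟨P₁, P₂, P₃, h1, h2, h3, h10, h20, h30, h12, h13, h23, hall⟩ := exists_three_two_torsion W
  obtain ⟨x₁, y₁, e₁, hP₁⟩ := exists_eq_some_of_ne_zero W h10
  obtain ⟨x₂, y₂, e₂, hP₂⟩ := exists_eq_some_of_ne_zero W h20
  obtain ⟨x₃, y₃, e₃, hP₃⟩ := exists_eq_some_of_ne_zero W h30
  -- distinct `x`-coordinates
  have hx12 : x₁ ≠ x₂ := by
    rintro rfl; exact h12 (eq_of_x_eq W hP₁ hP₂ h1)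
  have hx13 : x₁ ≠ x₃ := by
    rintro rfl; exact h13 (eq_of_x_eq W hP₁ hP₃ h1)
  have hx23 : x₂ ≠ x₃ := by
    rintro rfl; exact h23 (eq_of_x_eq W hP₂ hP₃ h2)
  set d : (AlgebraicClosure ℚ_[2]) := (x₁ - x₂) * (x₁ - x₃) * (x₂ - x₃) with hd
  -- every σ fixes d
  have hσd : ∀ σ : absoluteGaloisGroup ℚ_[2], σ • d = d := by
    intro σ
    have hσ2 : ∀ {P : localPoints W ℚ_[2]}, (2 : ℕ) • P = 0 → (2 : ℕ) • (σ • P) = 0 := fun {P} hP ↦ by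
      rw [smul_comm, hP, smul_zero]
    have hσ0 : ∀ {P : localPoints W ℚ_[2]}, P ≠ 0 → σ • P ≠ 0 := fun {P} hP h ↦
      hP ((smul_eq_zero_iff_eq σ).mp h)
    have hsmul_d : σ • d = (σ • x₁ - σ • x₂) * (σ • x₁ - σ • x₃) * (σ • x₂ - σ • x₃) := by
      simp only [hd, smul_mul', smul_sub]
    obtain ⟨e₁', hs₁⟩ := smul_eq_some W σ hP₁
    obtain ⟨e₂', hs₂⟩ := smul_eq_some W σ hP₂
    obtain ⟨e₃', hs₃⟩ := smul_eq_some W σ hP₃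
    by_cases hfix1 : σ • P₁ = P₁
    · -- σ fixes P₁, hence P₂ and P₃
      have hfix2 := H σ _ _ h1 h10 hfix1 h2
      have hfix3 := H σ _ _ h1 h10 hfix1 h3
      rw [hsmul_d, x_eq_of_eq_some W hs₁ (hfix1.trans hP₁), x_eq_of_eq_some W hs₂ (hfix2.trans hP₂),
        x_eq_of_eq_some W hs₃ (hfix3.trans hP₃)]
    · -- σ fixes no point of order 2: it is a 3-cycle on {P₁, P₂, P₃}
      have hnf2 : σ • P₂ ≠ P₂ := fun hf ↦ hfix1 (H σ _ _ h2 h20 hf h1)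
      have hnf3 : σ • P₃ ≠ P₃ := fun hf ↦ hfix1 (H σ _ _ h3 h30 hf h1)
      rcases hall _ (hσ2 h1) with h0 | h11 | h1to2 | h1to3
      · exact absurd h0 (hσ0 h10)
      · exact absurd h11 hfix1
      · -- σP₁ = P₂; then σP₂ = P₃ and σP₃ = P₁
        rcases hall _ (hσ2 h2) with h0 | h21 | h22 | h2to3
        · exact absurd h0 (hσ0 h20)
        · rcases hall _ (hσ2 h3) with h0 | h31 | h32 | h33
          · exact absurd h0 (hσ0 h30)
          · exact absurd (smul_left_cancel σ (h21.trans h31.symm)) h23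
          · exact absurd (smul_left_cancel σ (h1to2.trans h32.symm)) h13
          · exact absurd h33 hnf3
        · exact absurd h22 hnf2
        · rcases hall _ (hσ2 h3) with h0 | h31 | h32 | h33
          · exact absurd h0 (hσ0 h30)
          · rw [hsmul_d, x_eq_of_eq_some W hs₁ (h1to2.trans hP₂), x_eq_of_eq_some W hs₂ (h2to3.trans hP₃),
              x_eq_of_eq_some W hs₃ (h31.trans hP₁), hd]
            ring
          · exact absurd (smul_left_cancel σ (h1to2.trans h32.symm)) h13
          · exact absurd h33 hnf3
      · -- σP₁ = P₃; then σP₃ = P₂ and σP₂ = P₁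
        rcases hall _ (hσ2 h3) with h0 | h31 | h32 | h33
        · exact absurd h0 (hσ0 h30)
        · rcases hall _ (hσ2 h2) with h0 | h21 | h22 | h2to3
          · exact absurd h0 (hσ0 h20)
          · exact absurd (smul_left_cancel σ (h21.trans h31.symm)) h23
          · exact absurd h22 hnf2
          · exact absurd (smul_left_cancel σ (h1to3.trans h2to3.symm)) h12
        · rcases hall _ (hσ2 h2) with h0 | h21 | h22 | h2to3
          · exact absurd h0 (hσ0 h20)
          · rw [hsmul_d, x_eq_of_eq_some W hs₁ (h1to3.trans hP₃), x_eq_of_eq_some W hs₃ (h32.trans hP₂),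
              x_eq_of_eq_some W hs₂ (h21.trans hP₁), hd]
            ring
          · exact absurd h22 hnf2
          · exact absurd (smul_left_cancel σ (h1to3.trans h2to3.symm)) h12
        · exact absurd h33 hnf3
  -- hence d ∈ ℚ₂ and Δ_min = 16 d₀²: contradiction
  obtain ⟨d₀, hd₀⟩ := exists_algebraMap_eq_of_forall_smul_eq hσd
  have hΔ := minimalDiscriminantInt_eq_sixteen_mul_sq W
    (isRoot_twoTorsionPolynomial_of_eq_some W hP₁ h1) (isRoot_twoTorsionPolynomial_of_eq_some W hP₂ h2)
    (isRoot_twoTorsionPolynomial_of_eq_some W hP₃ h3) hx12 hx13 hx23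
  rw [← hd, ← hd₀, show (16 : (AlgebraicClosure ℚ_[2])) * (algebraMap ℚ_[2] (AlgebraicClosure ℚ_[2]) d₀) ^ 2 = algebraMap ℚ_[2] (AlgebraicClosure ℚ_[2]) (16 * d₀ ^ 2) by
      rw [map_mul, map_pow, map_ofNat]] at hΔ
  exact minimalDiscriminantInt_ne_sixteen_mul_sq W hss d₀ ((algebraMap ℚ_[2] (AlgebraicClosure ℚ_[2])).injective hΔ)

end Mixed

/-! ## §3 Assembly: residual rigidity at `2`, and the two-maps form used by the transport stub -/

section Assembly

variable (W : WeierstrassCurve ℚ) [W.IsElliptic] [W.IsGloballyMinimal]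

/-- **Residual rigidity at a good supersingular `2`.** Every injective additive endomorphism of `E(ℚ̄₂)[2]` commuting
with `Gal(ℚ̄₂/ℚ₂)` is the identity: the image of `Gal(ℚ̄₂/ℚ₂)` in `Aut E[2] ≅ GL₂(𝔽₂) ≅ S₃` has trivial centraliser
(§1 with (i) = §2 and (ii) = §3). [cite: Serre1972, §5.3] [cite: BDKim2009, Prop. 2.11–2.12 (p. 186)] -/
theorem residualRigidity_two (hss : GoodSS W 2) (β : ↥((localPoints W ℚ_[2])[(2 : ℕ)]) →+ ↥((localPoints W ℚ_[2])[(2 : ℕ)]))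
    (hβinj : Function.Injective β)
    (hβ : ∀ (σ : absoluteGaloisGroup ℚ_[2]) (v : ↥((localPoints W ℚ_[2])[(2 : ℕ)])), β (σ • v) = σ • β v)
    (v : ↥((localPoints W ℚ_[2])[(2 : ℕ)])) : β v = v := by
  have h2ne : ((2 : ℕ) : (AlgebraicClosure ℚ_[2])) ≠ 0 := by norm_num
  have hcard : Nat.card ((localPoints W ℚ_[2])[(2 : ℕ)]) = 4 :=
    (WeierstrassCurve.card_torsionPoints_eq_sq_holds W (AlgebraicClosure ℚ_[2]) (n := 2) h2ne).trans (by norm_num)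
  have hmem : ∀ {Q : localPoints W ℚ_[2]}, Q ∈ (localPoints W ℚ_[2])[(2 : ℕ)] ↔ (2 : ℕ) • Q = 0 :=
    fun {Q} ↦ AddSubgroup.torsionBy.nsmul_iff
  refine apply_eq_self_of_commute (G := absoluteGaloisGroup ℚ_[2]) hcard ?_ ?_ β hβinj hβ v
  · intro u hu
    apply Subtype.ext
    exact eq_zero_of_forall_smul_eq_of_two_nsmul_padic W hss (fun σ ↦ congrArg Subtype.val (hu σ)) (hmem.mp u.2)
  · obtain ⟨σ, P, Q, hP2, hP0, hσP, hQ2, hσQ⟩ := exists_smul_eq_and_smul_ne W hss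
    refine ⟨σ, ⟨P, hmem.mpr hP2⟩, ⟨Q, hmem.mpr hQ2⟩, fun h ↦ hP0 (congrArg Subtype.val h), Subtype.ext hσP,
      fun h ↦ hσQ (congrArg Subtype.val h)⟩

/-- **Two-maps form (the shape used by the local transport stub `stub_sel2Tb`).** Let `X` be an abelian group of order
`4` killed by `2` (e.g. `W[2](ℚ̄)`), and `f, g : X → A(ℚ̄₂)` two injective additive maps which are equivariant for the
same "restriction" of every `σ ∈ Gal(ℚ̄₂/ℚ₂)` to `X` (e.g. `x ↦ res_ι(σ) • x` for an embedding `ι : ℚ̄ → ℚ̄₂`). If `A` has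
good supersingular reduction at `2`, then `f = g`: `f ∘ g⁻¹` is an equivariant automorphism of `A(ℚ̄₂)[2]`, hence the
identity by `residualRigidity_two`. [cite: BDKim2009, Prop. 2.11–2.12 (p. 186)] [cite: Serre1972, §5.3] -/
theorem eq_of_injective_of_equivariant (A : WeierstrassCurve ℚ) [A.IsElliptic] [A.IsGloballyMinimal] (hssA : GoodSS A 2)
    {X : Type*} [AddCommGroup X] (hX : Nat.card X = 4) (hX2 : ∀ x : X, (2 : ℕ) • x = 0)
    (f g : X →+ localPoints A ℚ_[2]) (hf : Function.Injective f) (hg : Function.Injective g)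
    (hτ : ∀ σ : absoluteGaloisGroup ℚ_[2], ∃ τ : X → X, ∀ x, f (τ x) = σ • f x ∧ g (τ x) = σ • g x) :
    f = g := by
  have h2ne : ((2 : ℕ) : (AlgebraicClosure ℚ_[2])) ≠ 0 := by norm_num
  have hcard : Nat.card ((localPoints A ℚ_[2])[(2 : ℕ)]) = 4 :=
    (WeierstrassCurve.card_torsionPoints_eq_sq_holds A (AlgebraicClosure ℚ_[2]) (n := 2) h2ne).trans (by norm_num)
  haveI : Finite ↥((localPoints A ℚ_[2])[(2 : ℕ)]) := Nat.finite_of_card_ne_zero (by rw [hcard]; norm_num)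
  have hmem : ∀ {Q : localPoints A ℚ_[2]}, Q ∈ (localPoints A ℚ_[2])[(2 : ℕ)] ↔ (2 : ℕ) • Q = 0 :=
    fun {Q} ↦ AddSubgroup.torsionBy.nsmul_iff
  -- corestrictions to `A[2]`
  have hfT : ∀ x, f x ∈ (localPoints A ℚ_[2])[(2 : ℕ)] := fun x ↦ hmem.mpr (by rw [← map_nsmul, hX2, map_zero])
  have hgT : ∀ x, g x ∈ (localPoints A ℚ_[2])[(2 : ℕ)] := fun x ↦ hmem.mpr (by rw [← map_nsmul, hX2, map_zero])
  set f' : X →+ ↥((localPoints A ℚ_[2])[(2 : ℕ)]) := f.codRestrict _ hfT with hf'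
  set g' : X →+ ↥((localPoints A ℚ_[2])[(2 : ℕ)]) := g.codRestrict _ hgT with hg'
  have hf'inj : Function.Injective f' := fun x y h ↦ hf (congrArg Subtype.val h)
  have hg'inj : Function.Injective g' := fun x y h ↦ hg (congrArg Subtype.val h)
  have hg'bij : Function.Bijective g' := hg'inj.bijective_of_nat_card_le (by rw [hcard, hX])
  set eg : X ≃+ ↥((localPoints A ℚ_[2])[(2 : ℕ)]) := AddEquiv.ofBijective g' hg'bij with heg
  set β : ↥((localPoints A ℚ_[2])[(2 : ℕ)]) →+ ↥((localPoints A ℚ_[2])[(2 : ℕ)]) :=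
    f'.comp eg.symm.toAddMonoidHom with hβ
  have hβinj : Function.Injective β := hf'inj.comp eg.symm.injective
  have hβg : ∀ x, β (g' x) = f' x := fun x ↦ by
    change f' (eg.symm (eg x)) = f' x
    rw [AddEquiv.symm_apply_apply]
  have hβσ : ∀ (σ : absoluteGaloisGroup ℚ_[2]) (v : ↥((localPoints A ℚ_[2])[(2 : ℕ)])), β (σ • v) = σ • β v := by
    intro σ v
    obtain ⟨x, rfl⟩ := hg'bij.2 v
    obtain ⟨τ, hτ⟩ := hτ σ
    have h1 : σ • g' x = g' (τ x) := Subtype.ext (by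
      change σ • g x = g (τ x); exact ((hτ x).2).symm)
    rw [h1, hβg, hβg]
    exact Subtype.ext (hτ x).1
  ext x
  have h := residualRigidity_two A hssA β hβinj hβσ (g' x)
  rw [hβg] at h
  exact congrArg Subtype.val h

end Assembly


end Summit.BirchSwinnertonDyer.BirchSwinnertonDyer.Theorems.SignedTransportAtTwo

end
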